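import Summits.BirchSwinnertonDyer.BirchSwinnertonDyer.Theorems.EisensteinPrimesMazurMCOnCellBKummerCharacterCount
import Literature.NumberTheory.EllipticCurves.WeilPairingProofs
import HarnessLib

/-!
# The Kummer-character count with the quotient hypothesis DISCHARGED: `E[p]/⟨P̃⟩` has no fixed vector
# by the Weil pairing and `μ_p(ℚ) = 1`, so at an odd multiplicative `p` with `p ∣ #E(ℚ)_tors` a
# certified group `V` of Kummer characters alone gives `GeneratorCountGE` / `AlgebraicLambdaGE`
# (route `EisensteinPrimes`, crux 3 `MazurMCOnCellB` = stmt-BirchSwinnertonDyer-19033, line `mudescent`,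
# stub 4″ `stub_lambdaCountWeak_offLocus`, ALGEBRAIC half; width seat bsd-line-x2-p1-w3, D-0154 row 5)

HONEST FRAMING (cell `bsd-eis`; nothing here proves BSD or a main conjecture; 0 cells move): THEOREMS
ONLY — no definition, no named fact, nothing asserted about any particular curve, closes nothing.
Companion of `…KummerCharacterCount` (p630234), whose socket carried the hypothesis `hΨ`: «every
`Q ∈ E[p]` with `σQ − Q ∈ ℤ·P̃` for all `σ ∈ Γ` lies in `ℤ·P̃`» (no fixed vector in `E[p]/⟨P̃⟩`). Here:

* §1 `mem_zmultiples_of_forall_smul_sub_mem` — for ANY field `K` of characteristic `0` WITHOUT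
  non-trivial `p`-th roots of unity (`hμK : c^p = 1 → c = 1` in `K`), `E = W/K` elliptic, `P̃ ∈ E[p]`
  non-zero and `Γ_K`-fixed: `hΨ` HOLDS. Proof by the Weil pairing `e_p` (tree theorem
  `WeierstrassCurve.exists_weilPairing_holds`: bilinear, alternating, non-degenerate, Galois
  equivariant, values in `μ_p(K̄)`): `ζ = e_p(P̃, Q)` is `Γ_K`-fixed (`σQ = Q + kP̃` and
  `e_p(P̃, ℤP̃) = 1`), hence in `K` (Mathlib `InfiniteGalois.mem_range_algebraMap_iff_fixed`), hence
  `1`; then `e_p(·, P̃)` kills `P̃` and `Q`, and if `Q ∉ ℤ·P̃` the subgroup it kills has order `> p`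
  dividing `#E[p] = p²` (tree `card_torsionPoints_eq_sq_holds`), i.e. is `E[p]` — contradicting
  non-degeneracy. `eq_one_of_pow_eq_one_rat`: `ℚ` has no `p`-th root of unity `≠ 1` for `p` odd.
* §2 `X2.generatorCountGE_of_kummerCharacters` / `X2.algebraicLambdaGE_of_kummerCharacters` — the
  X2 corollaries of p630234 with `hΨ` discharged: `W/ℚ` globally minimal, `p` odd MULTIPLICATIVE with
  `p ∣ #E(ℚ)_tors`, `T ⊇` bad places and `v ∣ p`, `V` a finite group of continuous characters
  `Γ_ℚ →ₜ* ℤ/p` each trivial on `Γ_{ℚ_p}` and, at every `v ∤ p`, unramified or at a Kummer place;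
  then `GeneratorCountGE W p b` for `p^{b + 2·v_p(#E(ℚ)_tors)} ≤ #V`, and with `μ_an ≤ m`
  (`X2.AnalyticMuLE W p m`) **`AlgebraicLambdaGE W p (b − m)`** (named facts `h415`, `hWu`, `hpar` as
  in p469158). The only per-pair input left is the certificate `V` (class field theory: e.g. the
  degree-`p` subfields of `ℚ(ζ_ℓ)`, `ℓ ≡ 1 (mod p)` a Kummer prime, in which `p` splits completely).

References: [SilvermanAEC2009] III.8 (Weil pairing), Cor. III.6.4; [GreenbergLNM1716] §5 proof of
Prop. 5.10, p. 137; [GreenbergVatsal2000] §2; [Wuthrich2014] Thm. 16.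
-/

set_option autoImplicit false
-- `Summit.BirchSwinnertonDyer.BirchSwinnertonDyer.…`: the summit and its single sub-problem share a name (D-0017 layout).
set_option linter.dupNamespace false

noncomputable section

open scoped Classical

open Function Field NumberField IsDedekindDomain WeierstrassCurve
  Literature.NumberTheory.EllipticCurves Literature.NumberTheory.GaloisRepresentations
  Literature.NumberTheory.EllipticCurves.Rank1Residual Literature.NumberTheory.EllipticCurves.ModularForms
  Summit.BirchSwinnertonDyer.Rank1Residual
  Summit.BirchSwinnertonDyer.Rank1Residual.X1.GeneratorCountSqueeze
  Summit.BirchSwinnertonDyer.Rank1Residual.X1.TamagawaSqueeze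
  Summit.BirchSwinnertonDyer.BirchSwinnertonDyer.Theorems.EisensteinPrimesMazurMCOnCellBKummerCharacterCount

universe u

namespace Summit.BirchSwinnertonDyer.BirchSwinnertonDyer.Theorems.EisensteinPrimesMazurMCOnCellBKummerCharacterCountOfTorsion

/-! ## §1. `E[p]/⟨P̃⟩` has no fixed vector when `K` has no `p`-th root of unity (Weil pairing) -/

section Weil

variable {K : Type u} [Field K] [CharZero K] (W : WeierstrassCurve K) [W.IsElliptic] {p : ℕ}
  [hp : Fact p.Prime]

/-- **No fixed vector in `E[p]/⟨P̃⟩` (`hΨ` of the Kummer-character socket), for a field `K` of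
characteristic `0` with no `p`-th root of unity `≠ 1`.** `E = W/K` elliptic, `P̃ ∈ E[p] = E(K̄)[p]`
non-zero and `Γ_K`-fixed; then every `Q ∈ E[p]` with `σQ − Q ∈ ℤ·P̃` for all `σ ∈ Γ_K` lies in
`ℤ·P̃`. Weil pairing: `e_p(P̃, Q)` is `Γ_K`-fixed, so equals `1`; `e_p(·, P̃)` then kills the subgroup
generated by `P̃` and `Q`, which is all of `E[p]` (order `p²`) unless `Q ∈ ℤ·P̃` — contradicting
non-degeneracy. [cite: SilvermanAEC2009, Prop. III.8.1 and Cor. III.6.4] -/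
theorem mem_zmultiples_of_forall_smul_sub_mem (hμK : ∀ c : K, c ^ p = 1 → c = 1)
    (Pt : geomTorsion W (p : ℤ)) (hPt : ∀ σ : absoluteGaloisGroup K, σ • Pt = Pt) (hPt0 : Pt ≠ 0)
    (Q : geomTorsion W (p : ℤ))
    (hQ : ∀ σ : absoluteGaloisGroup K, σ • Q - Q ∈ AddSubgroup.zmultiples Pt) :
    Q ∈ AddSubgroup.zmultiples Pt := by
  haveI : NeZero p := ⟨hp.out.ne_zero⟩
  haveI : Finite (geomTorsion W (p : ℤ)) := finite_geomTorsion_of_neZero W p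
  have hpK : (p : K) ≠ 0 := Nat.cast_ne_zero.mpr hp.out.ne_zero
  obtain ⟨e, hpow, hadd₁, hadd₂, halt, hnondeg, hgal⟩ :=
    WeierstrassCurve.exists_weilPairing_holds W p hp.out.two_le hpK
  have he0 : ∀ S T, e S T ≠ 0 := fun S T h ↦ by
    have h1 := hpow S T
    rw [h, zero_pow hp.out.ne_zero] at h1
    exact zero_ne_one h1
  have he_zero_right : ∀ S, e S 0 = 1 := fun S ↦ by
    have h := hadd₂ S 0 0
    rw [add_zero] at h
    exact mul_left_cancel₀ (he0 S 0) (h.symm.trans (mul_one _).symm)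
  have he_zero_left : ∀ T, e 0 T = 1 := fun T ↦ by
    have h := hadd₁ 0 0 T
    rw [add_zero] at h
    exact mul_left_cancel₀ (he0 0 T) (h.symm.trans (mul_one _).symm)
  -- `e(P̃, ·)` kills `ℤ·P̃`
  have hker : ∀ T ∈ AddSubgroup.zmultiples Pt, e Pt T = 1 := by
    intro T hT
    refine AddSubgroup.closure_induction (p := fun x _ ↦ e Pt x = 1) ?_ (he_zero_right Pt) ?_ ?_
      ((AddSubgroup.zmultiples_eq_closure Pt) ▸ hT)
    · intro x hx
      rw [Set.mem_singleton_iff.mp hx]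
      exact halt Pt
    · intro x y _ _ hx hy
      rw [hadd₂, hx, hy, one_mul]
    · intro x _ hx
      have h := hadd₂ Pt x (-x)
      rw [add_neg_cancel, he_zero_right, hx, one_mul] at h
      exact h.symm
  -- `ζ = e(P̃, Q)` is `Γ_K`-fixed, hence `1`
  have hζfix : ∀ σ : absoluteGaloisGroup K, σ • e Pt Q = e Pt Q := fun σ ↦ by
    rw [hgal, hPt, show σ • Q = Q + (σ • Q - Q) by abel, hadd₂, hker _ (hQ σ), mul_one]
  haveI : IsGalois K (AlgebraicClosure K) := {}
  obtain ⟨c, hc⟩ := (InfiniteGalois.mem_range_algebraMap_iff_fixed (e Pt Q)).mpr fun f ↦ hζfix f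
  have hc1 : c = 1 := hμK c ((algebraMap K (AlgebraicClosure K)).injective (by
    rw [map_pow, hc, hpow, map_one]))
  have hζ : e Pt Q = 1 := by rw [← hc, hc1, map_one]
  -- `e(·, P̃)` kills `P̃`, `Q`; if `Q ∉ ℤ·P̃` it kills everything
  by_contra hQmem
  have hQ1 : e Q Pt = 1 := by
    have h := halt (Pt + Q)
    rw [hadd₁, hadd₂, hadd₂, halt, hζ, halt, one_mul, one_mul, mul_one] at h
    exact h
  let K₀ : AddSubgroup (geomTorsion W (p : ℤ)) :=
    { carrier := {S | e S Pt = 1}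
      zero_mem' := he_zero_left Pt
      add_mem' := fun {a b} ha hb ↦ by
        change e (a + b) Pt = 1
        rw [hadd₁, ha, hb, one_mul]
      neg_mem' := fun {a} ha ↦ by
        change e (-a) Pt = 1
        have h := hadd₁ a (-a) Pt
        rw [add_neg_cancel, he_zero_left, ha, one_mul] at h
        exact h.symm }
  have hPtK : Pt ∈ K₀ := halt Pt
  have hQK : Q ∈ K₀ := hQ1
  have hle : AddSubgroup.zmultiples Pt ≤ K₀ := AddSubgroup.zmultiples_le_of_mem hPtK
  -- cardinalities: `#ℤP̃ = p`, `#E[p] = p²`, so `K₀ = E[p]`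
  have hpPt : p • Pt = 0 := Subtype.ext (by
    rw [AddSubgroupClass.coe_nsmul, ZeroMemClass.coe_zero]
    exact AddSubgroup.torsionBy.nsmul_iff.mp Pt.2)
  have hcardZ : Nat.card (AddSubgroup.zmultiples Pt) = p := by
    rw [Nat.card_zmultiples, addOrderOf_eq_prime hpPt hPt0]
  have hcardM : Nat.card (geomTorsion W (p : ℤ)) = p ^ 2 :=
    WeierstrassCurve.card_torsionPoints_eq_sq_holds W (AlgebraicClosure K) (n := p)
      (by exact_mod_cast (Nat.cast_ne_zero (R := AlgebraicClosure K)).mpr hp.out.ne_zero)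
  have hdvd1 : p ∣ Nat.card K₀ := by
    have h := AddSubgroup.card_dvd_of_le hle
    rwa [hcardZ] at h
  have hdvd2 : Nat.card K₀ ∣ p ^ 2 := by
    have h := AddSubgroup.card_addSubgroup_dvd_card K₀
    rwa [hcardM] at h
  have hne : Nat.card K₀ ≠ p := by
    intro h
    have heq : AddSubgroup.zmultiples Pt = K₀ :=
      AddSubgroup.eq_of_le_of_card_ge hle (by rw [h, hcardZ])
    apply hQmem
    rw [heq]
    exact hQK
  have hcardK : Nat.card K₀ = p ^ 2 := by
    obtain ⟨i, hi, hK⟩ := (Nat.dvd_prime_pow hp.out).mp hdvd2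
    have hi0 : i ≠ 0 := by
      rintro rfl
      rw [pow_zero] at hK
      rw [hK] at hdvd1
      exact absurd (Nat.le_of_dvd one_pos hdvd1) (not_le.mpr hp.out.one_lt)
    have hi1 : i ≠ 1 := by
      rintro rfl
      rw [pow_one] at hK
      exact hne hK
    have hi2 : i = 2 := by omega
    rw [hK, hi2]
  have htop : K₀ = ⊤ := AddSubgroup.eq_top_of_card_eq K₀ (hcardK.trans hcardM.symm)
  have hall : ∀ S, e S Pt = 1 := fun S ↦ by
    have h : S ∈ K₀ := by rw [htop]; exact AddSubgroup.mem_top S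
    exact h
  exact hPt0 (hnondeg Pt hall)

end Weil

/-- **`ℚ` has no `p`-th root of unity other than `1`, for `p` odd**: `c^p = 1 ⇒ c = 1`
(`x ↦ x^p` is strictly monotone on `ℚ` for odd `p`). [folklore] -/
theorem eq_one_of_pow_eq_one_rat {p : ℕ} [hp : Fact p.Prime] (hodd : p ≠ 2) (c : ℚ)
    (hc : c ^ p = 1) : c = 1 := by
  have hoddp : Odd p := hp.out.odd_of_ne_two hodd
  have h1 : c ^ p = (1 : ℚ) ^ p := by rw [one_pow]; exact hc
  exact (Odd.strictMono_pow hoddp).injective h1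

/-! ## §2. X2: the Kummer-character count at `p ∣ #E(ℚ)_tors`, hypothesis `hΨ` discharged -/

section X2

variable {W : WeierstrassCurve ℚ} [W.IsElliptic] [W.IsGloballyMinimal] {p : ℕ} [hp : Fact p.Prime]

/-- **X2 Kummer-character count, `hΨ` discharged.** `W/ℚ` globally minimal, `p` odd of
multiplicative reduction with `p ∣ #E(ℚ)_tors`; `T ⊇` the bad places and the places above `p`; `V` a
finite group of continuous characters `χ : Γ_ℚ →ₜ* Multiplicative (ZMod p)`, each trivial on `Γ_{ℚ_v}`
for `v ∣ p` and, at every `v ∤ p`, unramified or at a KUMMER place (split multiplicative, `v(j(E))` not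
a `p`-th power). Then `GeneratorCountGE W p b` whenever `p^{b + 2·v_p(#E(ℚ)_tors)} ≤ #V`
(p630234's `X2.generatorCountGE_of_kummerCharacters_of_dvd_torsionOrder` + §1 over `ℚ`).
[cite: GreenbergLNM1716, §5 proof of Prop. 5.10, pp. 114–118, p. 137] [cite: SilvermanAEC2009, Prop. III.8.1] -/
theorem X2.generatorCountGE_of_kummerCharacters (hodd : p ≠ 2)
    (hmult : W.HasMultiplicativeReductionAtPrime p) (htors : p ∣ W.torsionOrder)
    (T : Finset (HeightOneSpectrum (𝓞 ℚ))) (hTbad : ∀ v, ¬ W.HasGoodReductionAt v → v ∈ T)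
    (hTp : ∀ v : HeightOneSpectrum (𝓞 ℚ), ((p : ℕ) : 𝓞 ℚ) ∈ v.asIdeal → v ∈ T)
    (V : Subgroup (absoluteGaloisGroup ℚ →ₜ* Multiplicative (ZMod p))) [Finite V]
    (hVp : ∀ χ ∈ V, ∀ v : HeightOneSpectrum (𝓞 ℚ), ((p : ℕ) : 𝓞 ℚ) ∈ v.asIdeal →
      ∀ σ : absoluteGaloisGroup (v.adicCompletion ℚ), χ (resGal (K := ℚ) (v.adicCompletion ℚ) σ) = 1)
    (hV : ∀ χ ∈ V, ∀ v : HeightOneSpectrum (𝓞 ℚ), ((p : ℕ) : 𝓞 ℚ) ∉ v.asIdeal →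
      (∀ τ ∈ absInertia (v.adicCompletion ℚ), χ (resGal (K := ℚ) (v.adicCompletion ℚ) τ) = 1) ∨
      (W.HasSplitMultiplicativeReductionAt v ∧ ∀ x : v.adicCompletion ℚ,
        Valued.v (algebraMap ℚ (v.adicCompletion ℚ) W.j) ≠ Valued.v x ^ p))
    {b : ℕ} (hb : p ^ (b + 2 * (W.torsionOrder).factorization p) ≤ Nat.card V) :
    GeneratorCountGE W p b :=
  X2.generatorCountGE_of_kummerCharacters_of_dvd_torsionOrder hodd hmult htors
    (fun Pt hPt0 hPt Q hQ ↦ mem_zmultiples_of_forall_smul_sub_mem W (eq_one_of_pow_eq_one_rat hodd)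
      Pt hPt hPt0 Q hQ) T hTbad hTp V hVp hV hb

/-- **X2, the λ-bound from Kummer characters, `hΨ` discharged: `AlgebraicLambdaGE W p (b − m)` for
`p^{b + 2·v_p(#E(ℚ)_tors)} ≤ #V` at a member with `μ_an ≤ m`** (`p ‖ N` odd, `p ∣ #E(ℚ)_tors`; named
facts `h415`, `hWu`, `hpar` as in p469158). At the étale end of a type-A class (`m = 0`,
`v_p(#E(ℚ)_tors) = 1`) with `#V = p^d`: `λ(X(E/ℚ_∞)) ≥ d − 2` — the layer-`0` algebraic budget at the
KUMMER primes, the per-pair input being the certificate `V` alone.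
[cite: GreenbergLNM1716, §5 pp. 114–118, p. 137, Prop. 4.15 (ii)] [cite: Wuthrich2014, Thm. 16 (p. 397)] -/
theorem X2.algebraicLambdaGE_of_kummerCharacters (hodd : p ≠ 2)
    (h415 : Greenberg1999.prop415ii_noFiniteSubmodule_of_ordinary_or_multiplicative)
    (hWu : Wuthrich2014.thm16_charIdeal_dvd_multiplicative_of_reducible)
    (hpar : nonempty_modularParametrizationData)
    (hmult : W.HasMultiplicativeReductionAtPrime p) (htors : p ∣ W.torsionOrder)
    (T : Finset (HeightOneSpectrum (𝓞 ℚ))) (hTbad : ∀ v, ¬ W.HasGoodReductionAt v → v ∈ T)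
    (hTp : ∀ v : HeightOneSpectrum (𝓞 ℚ), ((p : ℕ) : 𝓞 ℚ) ∈ v.asIdeal → v ∈ T)
    (V : Subgroup (absoluteGaloisGroup ℚ →ₜ* Multiplicative (ZMod p))) [Finite V]
    (hVp : ∀ χ ∈ V, ∀ v : HeightOneSpectrum (𝓞 ℚ), ((p : ℕ) : 𝓞 ℚ) ∈ v.asIdeal →
      ∀ σ : absoluteGaloisGroup (v.adicCompletion ℚ), χ (resGal (K := ℚ) (v.adicCompletion ℚ) σ) = 1)
    (hV : ∀ χ ∈ V, ∀ v : HeightOneSpectrum (𝓞 ℚ), ((p : ℕ) : 𝓞 ℚ) ∉ v.asIdeal →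
      (∀ τ ∈ absInertia (v.adicCompletion ℚ), χ (resGal (K := ℚ) (v.adicCompletion ℚ) τ) = 1) ∨
      (W.HasSplitMultiplicativeReductionAt v ∧ ∀ x : v.adicCompletion ℚ,
        Valued.v (algebraMap ℚ (v.adicCompletion ℚ) W.j) ≠ Valued.v x ^ p))
    {m : ℕ} (hμ : X2.AnalyticMuLE W p m)
    {b : ℕ} (hb : p ^ (b + 2 * (W.torsionOrder).factorization p) ≤ Nat.card V) :
    AlgebraicLambdaGE W p (b - m) :=
  X2.algebraicLambdaGE_of_kummerCharacters_of_dvd_torsionOrder hodd h415 hWu hpar hmult htors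
    (fun Pt hPt0 hPt Q hQ ↦ mem_zmultiples_of_forall_smul_sub_mem W (eq_one_of_pow_eq_one_rat hodd)
      Pt hPt hPt0 Q hQ) T hTbad hTp V hVp hV hμ hb

end X2

end Summit.BirchSwinnertonDyer.BirchSwinnertonDyer.Theorems.EisensteinPrimesMazurMCOnCellBKummerCharacterCountOfTorsion

end
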